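import Summits.AnomalousDissipation.AnomalousDissipation.Theorems.SolenoidalFractalHomogenisationLagrangianCarrierConstructionBookkeepingLevels
import Summits.AnomalousDissipation.AnomalousDissipation.Theorems.SolenoidalFractalHomogenisationPermissibleFractalCarrierTime
import HarnessLib

/-!
# K3L `LagrangianCarrierConstruction` (stmt-AnomalousDissipation-24913), line `birth`, stub `stub_bookkeepingL`:
# the Eulerian bookkeeping of the doubly-exponential family (helper; `--supports stmt-AnomalousDissipation-24913`)

Summits-side helper file (everything proved; no definitions, no named facts). `bookkeeping_core` builds, for every word
design `W`, constants `c, ν₀, K, θ₀ > 0` and minimal separation `Λ₀`, a `FractalCarrierData` replaying `W` with `gain = c`,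
`nu0 = ν₀`, `K = K` that is `Permissible`, obeys the separations `Λ₀ N_m ≤ N_{m+1}`, `N_m² ≤ N_{m+1}`, the amplitude law
`a_{m+1} ≤ N_{m+1}^{15/16}`, and exports the level data the Lagrangian clauses need: an integer `M ≥ 1` and integer ratio
roots `b_m` with `N_{m+1}/N_m = b_m^16`, `cellVisc_{m+1} b_m⁴ ≤ 1`, `K b_m⁴ ≤ b_m^16 cellVisc_{m+1}`,
`physPeriod_m = M b_m⁸ · physPeriod_{m+1}` and the STRAIN inequality `(a_1 + ⋯ + a_m) · b_m · physPeriod_{m+1} ≤ θ₀/b_m`.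

THE FAMILY. With `P = W.period`, integers `M ≥ max(1, 4/c, K²/c, P/θ₀)` and `B ≥ max(2, Λ₀, M(c+1), 1/ν₀ + 1)`,
`σ = √(cM)` (`σ ≥ 2`, `σ ≥ K`), `κ₀ = σ/B⁶`: `b_m = B^(2^m)`, `N_m = B^(16(2^m − 1))`, `kbar_m = κ₀ M^m / B^(24(2^m − 1))`
(so `kbar_m/kbar_{m+1} = b_m^24/M` is the Taylor gain `1 + c/ν_{m+1}²` of `…BookkeepingLevels.level_viscosity`), cell
viscosities `ν_m = √(cM/(B^(12·2^m) − M))`, amplitudes `a_m = kbar_m N_m²/ν_m` (so `cellVisc_m = ν_m`). Then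
`physPeriod_m = P/(kbar_m N_m²)`, the period ratio is `M b_m⁸ ∈ ℕ`, `kbar_{m+1} ≤ kbar_m/2 → 0`, the finer levels are
viscous-dominated because `kbar_j ν_m/kbar_m ≥ b^12 σ/M ≥ 1`, the Bloch threshold holds because `K/ν_{m+1} ≤ b_m^12 ≤ b_m^16`,
the strain clause reduces to `Σ_{j≤m} a_j ≤ 2a_m` (amplitude doubling) and `2P ≤ θ₀ M σ`, and the decay clause to
`a_{m+1} ≤ M^{m+1} B^{14(2^{m+1}−1)} ≤ B^{15(2^{m+1}−1)}` (`M ≤ B`).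
This is bookkeeping for the construction side of route-1's rung leaf F-D1.A0 (a frontier formal rung); it is NOT a proof of
anomalous dissipation, of Onsager's conjecture, or of the crux by itself.
-/

set_option linter.dupNamespace false

noncomputable section

namespace Summit.AnomalousDissipation.AnomalousDissipation.Theorems.SolenoidalFractalHomogenisation.LagrangianCarrierConstruction

open Filter Topology
open Literature.Analysis.FluidPDE Literature.Analysis.FluidPDE.LatticeShear
open Summit.AnomalousDissipation.AnomalousDissipation.Theorems.SolenoidalFractalHomogenisation.PermissibleCarrier
  (period_pos physPeriod_pos)

/-- **The Eulerian bookkeeping of the K3L birth family.** For every word design `W`, constants `c, ν₀, K, θ₀ > 0` and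
minimal separation `Λ₀`: a `Permissible` fractal-carrier datum replaying `W` (`gain = c`, `nu0 = ν₀`, `K = K`) with
`Λ₀ N_m ≤ N_{m+1}`, `N_m² ≤ N_{m+1}`, `a_{m+1} ≤ N_{m+1}^{1 − 1/16}`, together with an integer `M ≥ 1` and integer ratio
roots `b_m ≥ 1` such that `N_{m+1}/N_m = b_m^16`, `cellVisc_{m+1} b_m⁴ ≤ 1`, `K b_m⁴ ≤ b_m^16 cellVisc_{m+1}`,
`physPeriod_m = M b_m⁸ physPeriod_{m+1}` and `(a_1 + ⋯ + a_m) b_m physPeriod_{m+1} ≤ θ₀/b_m`.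
[cite: ArmstrongVicol2025, §3 (3.42)–(3.43) (parameter bookkeeping) and §2.2 (PDF p. 12: the refresh-window constraints)] -/
theorem bookkeeping_core : ∀ k (W : LatticeShear.LatticeWord k) (c ν₀ K θ₀ : ℝ) (Λ₀ : ℕ),
    0 < c → 0 < ν₀ → 0 < K → 0 < θ₀ →
    ∃ D : LatticeShear.FractalCarrierData k, D.design = W ∧ D.gain = c ∧ D.nu0 = ν₀ ∧ D.K = K ∧
      D.Permissible ∧ (∀ m, Λ₀ * D.N m ≤ D.N (m + 1)) ∧ (∀ m, D.N m ^ 2 ≤ D.N (m + 1)) ∧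
      (∀ m, D.a (m + 1) ≤ ((D.N (m + 1) : ℝ)) ^ (1 - 1 / 16 : ℝ)) ∧
      ∃ (M : ℕ) (b : ℕ → ℕ), 0 < M ∧ (∀ m, 0 < b m) ∧
        (∀ m, ((D.N (m + 1) : ℝ)) / D.N m = ((b m : ℕ) : ℝ) ^ 16) ∧
        (∀ m, D.cellVisc (m + 1) * ((b m : ℕ) : ℝ) ^ 4 ≤ 1) ∧
        (∀ m, K * ((b m : ℕ) : ℝ) ^ 4 ≤ ((b m : ℕ) : ℝ) ^ 16 * D.cellVisc (m + 1)) ∧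
        (∀ m, D.physPeriod m = (M : ℝ) * ((b m : ℕ) : ℝ) ^ 8 * D.physPeriod (m + 1)) ∧
        (∀ m, (∑ i ∈ Finset.range m, D.a (i + 1)) * (((b m : ℕ) : ℝ) * D.physPeriod (m + 1)) ≤
          θ₀ / ((b m : ℕ) : ℝ)) := by
  intro k W c ν₀ K θ₀ Λ₀ hc hν₀ hK hθ₀
  obtain ⟨P, hPdef⟩ : ∃ P : ℝ, P = W.period := ⟨_, rfl⟩
  have hP : 0 < P := by rw [hPdef]; exact period_pos W
  -- the integer `M`
  obtain ⟨M, hM⟩ := exists_nat_ge (max (1:ℝ) (max (4 / c) (max (K ^ 2 / c) (P / θ₀))))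
  simp only [max_le_iff] at hM
  obtain ⟨hM1, hM4, hMK, hMP⟩ := hM
  have hM0 : (0:ℝ) < M := by linarith
  have hMn0 : 0 < M := by exact_mod_cast hM0
  have hcM4 : 4 ≤ c * M := by have := (div_le_iff₀ hc).1 hM4; linarith
  have hcMK : K ^ 2 ≤ c * M := by have := (div_le_iff₀ hc).1 hMK; linarith
  have hPM : P ≤ θ₀ * M := by have := (div_le_iff₀ hθ₀).1 hMP; linarith
  have hcM0 : 0 ≤ c * M := by positivity
  -- `σ = √(cM)`
  obtain ⟨σ, hσdef⟩ : ∃ σ : ℝ, σ = Real.sqrt (c * M) := ⟨_, rfl⟩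
  have hσsq : σ ^ 2 = c * M := by rw [hσdef]; exact Real.sq_sqrt hcM0
  have hσ2 : 2 ≤ σ := by
    rw [hσdef, show (2:ℝ) = Real.sqrt (2 ^ 2) by rw [Real.sqrt_sq (by norm_num)]]
    exact Real.sqrt_le_sqrt (by linarith)
  have hσK : K ≤ σ := by
    rw [hσdef, show K = Real.sqrt (K ^ 2) by rw [Real.sqrt_sq hK.le]]
    exact Real.sqrt_le_sqrt hcMK
  have hσ0 : 0 < σ := by linarith
  have hσ1 : 1 ≤ σ := by linarith
  -- the integer `B`
  obtain ⟨B, hB⟩ := exists_nat_ge (max (2:ℝ) (max (Λ₀ : ℝ) (max ((M : ℝ) * (c + 1)) (1 / ν₀ + 1))))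
  simp only [max_le_iff] at hB
  obtain ⟨hB2, hBΛ, hBMc, hBν⟩ := hB
  have hBM' : (M : ℝ) < B := by nlinarith
  have hBM : (M : ℝ) ≤ B := hBM'.le
  have hB1 : (1:ℝ) ≤ B := by linarith
  have hB0 : (0:ℝ) < B := by linarith
  have hBn2 : 2 ≤ B := by exact_mod_cast hB2
  have hBn0 : 0 < B := by omega
  have hBnΛ : Λ₀ ≤ B := by exact_mod_cast hBΛ
  have hνB : 1 < ν₀ * B := by
    have h1 : 1 / ν₀ < B := by linarith
    have := (div_lt_iff₀ hν₀).1 h1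
    linarith
  have hbn : ∀ m, B ≤ B ^ 2 ^ m := fun m => Nat.le_self_pow (pow_ne_zero _ two_ne_zero) B
  have hbn16 : ∀ m, B ^ 2 ^ m ≤ (B ^ 2 ^ m) ^ 16 := fun m => Nat.le_self_pow (by norm_num) _
  -- the ratio roots `β m = B^(2^m)` (real)
  obtain ⟨β, hβ⟩ : ∃ β : ℕ → ℝ, ∀ m, β m = (B : ℝ) ^ 2 ^ m := ⟨_, fun _ => rfl⟩
  have hβcast : ∀ m, ((B ^ 2 ^ m : ℕ) : ℝ) = β m := fun m => by rw [hβ]; push_cast; rfl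
  have hβB : ∀ m, (B : ℝ) ≤ β m := fun m => by
    rw [hβ]; exact le_self_pow₀ hB1 (pow_ne_zero _ two_ne_zero)
  have hβ1 : ∀ m, (1 : ℝ) ≤ β m := fun m => le_trans hB1 (hβB m)
  have hβ0 : ∀ m, (0 : ℝ) < β m := fun m => lt_of_lt_of_le one_pos (hβ1 m)
  have hβ2 : ∀ m, (2 : ℝ) ≤ β m := fun m => le_trans hB2 (hβB m)
  have hβM : ∀ m, (M : ℝ) ≤ β m := fun m => le_trans hBM (hβB m)
  have hβsucc : ∀ m, β (m + 1) = β m ^ 2 := fun m => by rw [hβ, hβ, pow_succ, pow_mul]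
  have hβpow : ∀ m (n : ℕ), 1 ≤ n → β m ≤ β m ^ n := fun m n hn => le_self_pow₀ (hβ1 m) (by omega)
  have hb16 : ∀ m, (M : ℝ) * (c + 1) ≤ β m ^ 16 := fun m =>
    le_trans hBMc (le_trans (hβB m) (hβpow m 16 (by norm_num)))
  have hβ24 : ∀ m, (B : ℝ) ^ (12 * 2 ^ (m + 1)) = β m ^ 24 := fun m => by
    rw [hβ, ← pow_mul]; congr 1; rw [pow_succ]; ring
  have hβ12 : ∀ m, β m ^ 12 = β (m + 1) ^ 6 := fun m => by rw [hβsucc, ← pow_mul]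
  -- the cell viscosities `ν m = √(cM/(B^(12·2^m) − M))` and their one-level bounds
  obtain ⟨ν, hν⟩ : ∃ ν : ℕ → ℝ, ∀ m, ν m = Real.sqrt (c * M / ((B : ℝ) ^ (12 * 2 ^ m) - M)) := ⟨_, fun _ => rfl⟩
  have hνS : ∀ m, ν (m + 1) = Real.sqrt (c * M / (β m ^ 24 - M)) := fun m => by rw [hν, hβ24]
  have hνpos : ∀ m, 0 < ν m := fun m => by
    rw [hν]
    refine Real.sqrt_pos.2 (div_pos (by positivity) ?_)
    have h1 : (B : ℝ) ≤ (B : ℝ) ^ (12 * 2 ^ m) :=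
      le_self_pow₀ hB1 (Nat.mul_ne_zero (by norm_num) (pow_ne_zero _ two_ne_zero))
    linarith
  have hL : ∀ m, 0 < β m ^ 24 - M ∧ 0 < ν (m + 1) ∧ ν (m + 1) ^ 2 = c * M / (β m ^ 24 - M) ∧
      σ / β m ^ 12 ≤ ν (m + 1) ∧ ν (m + 1) ≤ 1 / β m ^ 4 ∧ 1 / ν (m + 1) ≤ β m ^ 12 / σ ∧
      1 + c / ν (m + 1) ^ 2 = β m ^ 24 / M := fun m => by
    rw [hνS]; exact level_viscosity hc hM1 hσsq hσ0 (hβ2 m) (hβM m) (hb16 m)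
  have hνK : ∀ m, K / β m ^ 12 ≤ ν (m + 1) := fun m =>
    le_trans (div_le_div_of_nonneg_right hσK (pow_nonneg (hβ0 m).le _)) (hL m).2.2.2.1
  -- the lattice sizes `N m = B^(16(2^m − 1))`
  obtain ⟨Nf, hN⟩ : ∃ N : ℕ → ℕ, ∀ m, N m = (B ^ (2 ^ m - 1)) ^ 16 := ⟨_, fun _ => rfl⟩
  have hN0 : Nf 0 = 1 := by rw [hN]; simp
  have hNsucc : ∀ m, Nf (m + 1) = Nf m * (B ^ 2 ^ m) ^ 16 := fun m => by
    rw [hN, hN, two_pow_succ_sub_one, pow_add, mul_pow]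
  have hNpos : ∀ m, 0 < Nf m := fun m => by rw [hN]; positivity
  have hNcast : ∀ m, ((Nf m : ℕ) : ℝ) = ((B : ℝ) ^ (2 ^ m - 1)) ^ 16 := fun m => by rw [hN]; push_cast; rfl
  have hNreal0 : ∀ m, (0 : ℝ) < Nf m := fun m => by exact_mod_cast hNpos m
  have hNcast_succ : ∀ m, ((Nf (m + 1) : ℕ) : ℝ) = (Nf m : ℝ) * β m ^ 16 := fun m => by
    rw [hNsucc, hβ]; push_cast; rfl
  have hratio : ∀ m, ((Nf (m + 1) : ℕ) : ℝ) / ((Nf m : ℕ) : ℝ) = β m ^ 16 := fun m => by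
    rw [hNcast_succ, mul_div_cancel_left₀ _ (hNreal0 m).ne']
  have hN_le : ∀ m, Nf m ≤ (B ^ 2 ^ m) ^ 16 := fun m => by
    rw [hN]; exact Nat.pow_le_pow_left (Nat.pow_le_pow_right hBn0 (Nat.sub_le _ _)) 16
  -- the renormalised viscosities `kbar m = κ₀ M^m / B^(24(2^m − 1))`, `κ₀ = σ/B⁶`
  obtain ⟨κ₀, hκ₀⟩ : ∃ κ₀ : ℝ, κ₀ = σ / (B : ℝ) ^ 6 := ⟨_, rfl⟩
  have hκ₀pos : 0 < κ₀ := by rw [hκ₀]; exact div_pos hσ0 (by positivity)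
  obtain ⟨kb, hkb⟩ : ∃ kb : ℕ → ℝ, ∀ m, kb m = κ₀ * (M : ℝ) ^ m / ((B : ℝ) ^ (2 ^ m - 1)) ^ 24 := ⟨_, fun _ => rfl⟩
  have hkbpos : ∀ m, 0 < kb m := fun m => by rw [hkb]; positivity
  have hkbsucc : ∀ m, kb (m + 1) = kb m * M / β m ^ 24 := fun m => by
    rw [hkb, hkb, two_pow_succ_sub_one, pow_add (B : ℝ) (2 ^ m - 1) (2 ^ m), mul_pow, hβ,
      pow_succ (M : ℝ) m]
    have h1 : ((B : ℝ) ^ (2 ^ m - 1)) ^ 24 ≠ 0 := by positivity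
    have h2 : ((B : ℝ) ^ (2 ^ m)) ^ 24 ≠ 0 := by positivity
    field_simp
  have hkb_le : ∀ m, kb (m + 1) ≤ kb m / 2 := fun m => by
    have hb := hβ0 m
    have hk := hkbpos m
    have h2M : 2 * (M : ℝ) ≤ β m ^ 24 :=
      calc 2 * (M : ℝ) ≤ β m * β m := mul_le_mul (hβ2 m) (hβM m) hM0.le hb.le
        _ = β m ^ 2 := by ring
        _ ≤ β m ^ 24 := pow_le_pow_right₀ (hβ1 m) (by norm_num)
    rw [hkbsucc, div_le_div_iff₀ (by positivity) two_pos]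
    nlinarith [h2M]
  have hkb_anti : Antitone kb := antitone_nat_of_succ_le fun m => by linarith [hkb_le m, hkbpos m]
  -- `Q m = kbar m · N m²` (so `physPeriod m = P / Q m`) and the amplitudes `a m = Q m / ν m`
  obtain ⟨Q, hQ⟩ : ∃ Q : ℕ → ℝ, ∀ m, Q m = kb m * (Nf m : ℝ) ^ 2 := ⟨_, fun _ => rfl⟩
  have hQpos : ∀ m, 0 < Q m := fun m => by rw [hQ]; exact mul_pos (hkbpos m) (pow_pos (hNreal0 m) 2)
  have hQsucc : ∀ m, Q (m + 1) = Q m * (M * β m ^ 8) := fun m => by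
    rw [hQ, hQ, hkbsucc, hNcast_succ]
    have := (hβ0 m).ne'
    field_simp
  have hQclosed : ∀ m, Q m = κ₀ * (M : ℝ) ^ m * ((B : ℝ) ^ (2 ^ m - 1)) ^ 8 := fun m => by
    rw [hQ, hkb, hNcast]
    have h1 : ((B : ℝ) ^ (2 ^ m - 1)) ≠ 0 := by positivity
    field_simp
  obtain ⟨af, haf⟩ : ∃ a : ℕ → ℝ, ∀ m, a m = kb m * (Nf m : ℝ) ^ 2 / ν m := ⟨_, fun _ => rfl⟩
  have haQ : ∀ m, af m = Q m / ν m := fun m => by rw [haf, hQ]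
  have hapos : ∀ m, 0 < af m := fun m => by rw [haQ]; exact div_pos (hQpos m) (hνpos m)
  -- amplitudes one level apart: `Q(m+1) β_m⁴ ≤ a(m+1) ≤ Q(m+1) β_m¹²/σ`; doubling; geometric sum
  have ha_up : ∀ m, af (m + 1) ≤ Q (m + 1) * β m ^ 12 / σ := fun m => by
    rw [haQ]
    calc Q (m + 1) / ν (m + 1) = Q (m + 1) * (1 / ν (m + 1)) := by ring
      _ ≤ Q (m + 1) * (β m ^ 12 / σ) := mul_le_mul_of_nonneg_left (hL m).2.2.2.2.2.1 (hQpos _).le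
      _ = Q (m + 1) * β m ^ 12 / σ := by ring
  have ha_low : ∀ m, Q (m + 1) * β m ^ 4 ≤ af (m + 1) := fun m => by
    rw [haQ]
    have hb := hβ0 m
    calc Q (m + 1) * β m ^ 4 = Q (m + 1) / (1 / β m ^ 4) := by field_simp
      _ ≤ Q (m + 1) / ν (m + 1) := div_le_div_of_nonneg_left (hQpos _).le (hνpos _) (hL m).2.2.2.2.1
  have ha_double : ∀ m, 2 * af (m + 1) ≤ af (m + 1 + 1) := fun m => by
    have h1 := ha_up m
    have h2 := ha_low (m + 1)
    rw [hQsucc] at h2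
    rw [hβ12] at h1
    have hQ1 := hQpos (m + 1)
    have hb := hβ1 (m + 1)
    have hb0 := hβ0 (m + 1)
    have h2σ : 2 / σ ≤ 1 := (div_le_one hσ0).2 hσ2
    have hb6 : β (m + 1) ^ 6 ≤ β (m + 1) ^ 12 := pow_le_pow_right₀ hb (by norm_num)
    have h3 : 2 * (Q (m + 1) * β (m + 1) ^ 6 / σ) ≤ Q (m + 1) * (M * β (m + 1) ^ 8) * β (m + 1) ^ 4 := by
      calc 2 * (Q (m + 1) * β (m + 1) ^ 6 / σ) = Q (m + 1) * β (m + 1) ^ 6 * (2 / σ) := by ring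
        _ ≤ Q (m + 1) * β (m + 1) ^ 6 * 1 := mul_le_mul_of_nonneg_left h2σ (by positivity)
        _ ≤ Q (m + 1) * β (m + 1) ^ 12 * 1 :=
            mul_le_mul_of_nonneg_right (mul_le_mul_of_nonneg_left hb6 hQ1.le) zero_le_one
        _ ≤ Q (m + 1) * β (m + 1) ^ 12 * M := mul_le_mul_of_nonneg_left hM1 (by positivity)
        _ = Q (m + 1) * (M * β (m + 1) ^ 8) * β (m + 1) ^ 4 := by ring
    linarith
  have ha_sum : ∀ m, ∑ i ∈ Finset.range (m + 1), af (i + 1) ≤ 2 * af (m + 1) :=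
    sum_range_le_two_mul_of_double (hapos 1).le ha_double
  -- the Eulerian bookkeeping datum
  set F : LatticeShear.FractalCarrierData k :=
    ⟨W, c, ν₀, K, Nf, af, kb, hc, hν₀, hK, hNpos, hapos, hkbpos⟩ with hFdef
  have hcell : ∀ m, F.cellVisc m = ν m := fun m => by
    show kb m * (Nf m : ℝ) ^ 2 / af m = ν m
    have h1 : kb m * (Nf m : ℝ) ^ 2 ≠ 0 := (mul_pos (hkbpos m) (pow_pos (hNreal0 m) 2)).ne'
    rw [haf, div_div_eq_mul_div, mul_div_cancel_left₀ _ h1]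
  have hpp : ∀ m, F.physPeriod m = P / Q m := fun m => by
    rw [physPeriod_eq, hQ, hPdef]
  refine ⟨F, rfl, rfl, rfl, rfl, ?_, ?_, ?_, ?_, M, fun m => B ^ 2 ^ m, hMn0, fun m => pow_pos hBn0 _,
    ?_, ?_, ?_, ?_, ?_⟩
  · -- `Permissible`
    show F.Permissible
    refine ⟨hN0, fun m => ⟨(B ^ 2 ^ m) ^ 16, hNsucc m⟩, fun m => ?_, fun m => ?_, fun m hm => ?_,
      fun m => ?_, fun j m hj hjm => ?_, fun m => ?_, ?_⟩
    · -- nested lattices: `2 N_m ≤ N_{m+1}`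
      show 2 * Nf m ≤ Nf (m + 1)
      rw [hNsucc, mul_comm]
      exact Nat.mul_le_mul_left _ (le_trans hBn2 (le_trans (hbn m) (hbn16 m)))
    · -- Taylor recursion: the gain of level `m+1` is `1 + c/ν² = β_m²⁴/M = kbar_m/kbar_{m+1}`
      show kb m = kb (m + 1) * (1 + c * af (m + 1) ^ 2 / (kb (m + 1) ^ 2 * ((Nf (m + 1) : ℕ) : ℝ) ^ 4))
      have hinner : c * af (m + 1) ^ 2 / (kb (m + 1) ^ 2 * ((Nf (m + 1) : ℕ) : ℝ) ^ 4) =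
          c / ν (m + 1) ^ 2 := by
        rw [haf]
        have h1 : kb (m + 1) ≠ 0 := (hkbpos _).ne'
        have h2 : ((Nf (m + 1) : ℕ) : ℝ) ≠ 0 := (hNreal0 _).ne'
        have h3 : ν (m + 1) ≠ 0 := (hνpos _).ne'
        field_simp
      rw [hinner, (hL m).2.2.2.2.2.2, hkbsucc]
      have h1 : (M : ℝ) ≠ 0 := hM0.ne'
      have h2 : β m ^ 24 ≠ 0 := (pow_pos (hβ0 m) 24).ne'
      have h3 : β m ≠ 0 := (hβ0 m).ne'
      field_simp
    · -- quasi-static levels: `cellVisc m = ν m ≤ 1/β⁴ ≤ 1/B < ν₀`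
      obtain ⟨j, rfl⟩ : ∃ j, m = j + 1 := ⟨m - 1, by omega⟩
      rw [hcell]
      show ν (j + 1) < ν₀
      calc ν (j + 1) ≤ 1 / β j ^ 4 := (hL j).2.2.2.2.1
        _ ≤ 1 / (B : ℝ) :=
            one_div_le_one_div_of_le hB0 (le_trans (hβB j) (hβpow j 4 (by norm_num)))
        _ < ν₀ := by rw [div_lt_iff₀ hB0]; linarith
    · -- Bloch threshold: `⌈K/ν_{m+1}⌉ N_m ≤ β_m¹² N_m ≤ N_{m+1}`
      show ((⌈K / F.cellVisc (m + 1)⌉₊ : ℕ) : ℝ) * ((Nf m : ℕ) : ℝ) ≤ ((Nf (m + 1) : ℕ) : ℝ)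
      rw [hcell]
      have hceil : ⌈K / ν (m + 1)⌉₊ ≤ (B ^ 2 ^ m) ^ 12 := by
        refine Nat.ceil_le.2 ?_
        push_cast
        rw [← hβ, div_le_iff₀ (hνpos _)]
        have := (div_le_iff₀ (pow_pos (hβ0 m) 12)).1 (hνK m)
        linarith
      have hnat : ⌈K / ν (m + 1)⌉₊ * Nf m ≤ Nf (m + 1) := by
        rw [hNsucc, mul_comm (Nf m)]
        exact Nat.mul_le_mul_right _
          (le_trans hceil (Nat.pow_le_pow_right (pow_pos hBn0 _) (by norm_num)))
      exact_mod_cast hnat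
    · -- finer levels viscous-dominated: `1 ≤ kbar_j N_m²/a_m = kbar_j ν_m/kbar_m`
      show (1 : ℝ) ≤ kb j * ((Nf m : ℕ) : ℝ) ^ 2 / af m
      obtain ⟨i, rfl⟩ : ∃ i, m = i + 1 := ⟨m - 1, by omega⟩
      have hji : j ≤ i := by omega
      rw [one_le_div (hapos _), haf, div_le_iff₀ (hνpos _)]
      have hb := hβ0 i
      have hk1 : kb (i + 1) ≤ kb j * M / β i ^ 24 := by
        rw [hkbsucc]
        exact div_le_div_of_nonneg_right (mul_le_mul_of_nonneg_right (hkb_anti hji) hM0.le)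
          (by positivity)
      have hk2 : kb j * M / β i ^ 24 ≤ kb j * ν (i + 1) := by
        have h1 : (M : ℝ) / β i ^ 24 ≤ σ / β i ^ 12 := by
          rw [div_le_div_iff₀ (by positivity) (by positivity)]
          have hb12 : β i ^ 12 * β i ≤ β i ^ 24 := by
            rw [← pow_succ]; exact pow_le_pow_right₀ (hβ1 i) (by norm_num)
          have h3 : (M : ℝ) * β i ^ 12 ≤ β i ^ 12 * β i := by
            rw [mul_comm]; exact mul_le_mul_of_nonneg_left (hβM i) (by positivity)
          calc (M : ℝ) * β i ^ 12 ≤ β i ^ 24 := le_trans h3 hb12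
            _ = 1 * β i ^ 24 := (one_mul _).symm
            _ ≤ σ * β i ^ 24 := mul_le_mul_of_nonneg_right hσ1 (by positivity)
        calc kb j * M / β i ^ 24 = kb j * (M / β i ^ 24) := by ring
          _ ≤ kb j * (σ / β i ^ 12) := mul_le_mul_of_nonneg_left h1 (hkbpos j).le
          _ ≤ kb j * ν (i + 1) := mul_le_mul_of_nonneg_left (hL i).2.2.2.1 (hkbpos j).le
      have hN2 : (0 : ℝ) ≤ ((Nf (i + 1) : ℕ) : ℝ) ^ 2 := by positivity
      calc kb (i + 1) * ((Nf (i + 1) : ℕ) : ℝ) ^ 2 ≤ (kb j * ν (i + 1)) * ((Nf (i + 1) : ℕ) : ℝ) ^ 2 :=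
            mul_le_mul_of_nonneg_right (le_trans hk1 hk2) hN2
        _ = kb j * ((Nf (i + 1) : ℕ) : ℝ) ^ 2 * ν (i + 1) := by ring
    · -- commensurable periods: `physPeriod m = (M β_m⁸) · physPeriod (m+1)`
      refine ⟨M * (B ^ 2 ^ m) ^ 8, Nat.mul_pos hMn0 (pow_pos (pow_pos hBn0 _) _), ?_⟩
      show ((M * (B ^ 2 ^ m) ^ 8 : ℕ) : ℝ) * F.physPeriod (m + 1) = F.physPeriod m
      rw [hpp, hpp, hQsucc]
      push_cast
      rw [← hβ]
      have := (hQpos m).ne'; have := hM0.ne'; have := (hβ0 m).ne'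
      field_simp
    · -- `kbar m → 0` (geometric: `kbar (m+1) ≤ kbar m / 2`)
      show Tendsto kb atTop (𝓝 0)
      exact tendsto_zero_of_succ_le_half (fun m => (hkbpos m).le) hkb_le
  · -- (T1a) prescribed separation `Λ₀ N_m ≤ N_{m+1}`
    intro m
    show Λ₀ * Nf m ≤ Nf (m + 1)
    rw [hNsucc, mul_comm]
    exact Nat.mul_le_mul_left _ (le_trans hBnΛ (le_trans (hbn m) (hbn16 m)))
  · -- (T1b) super-geometric separation `N_m² ≤ N_{m+1}`
    intro m
    show Nf m ^ 2 ≤ Nf (m + 1)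
    rw [hNsucc, pow_two]
    exact Nat.mul_le_mul_left _ (hN_le m)
  · -- (DEC) `a_{m+1} ≤ M^{m+1} B^{14(2^{m+1}−1)} ≤ B^{15(2^{m+1}−1)} = N_{m+1}^{15/16}`
    intro m
    show af (m + 1) ≤ (((Nf (m + 1) : ℕ) : ℝ)) ^ (1 - 1 / 16 : ℝ)
    rw [hNcast, rpow_pow_sixteen_dec (by positivity)]
    have hQD := hQclosed (m + 1)
    have hb12 : β m ^ 12 = (B : ℝ) ^ 6 * ((B : ℝ) ^ (2 ^ (m + 1) - 1)) ^ 6 := by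
      rw [hβ, ← pow_mul, ← pow_mul, ← pow_add]
      congr 1
      have := twelve_mul_two_pow m
      omega
    have hMD : (M : ℝ) ^ (m + 1) ≤ (B : ℝ) ^ (2 ^ (m + 1) - 1) :=
      calc (M : ℝ) ^ (m + 1) ≤ (B : ℝ) ^ (m + 1) := pow_le_pow_left₀ hM0.le hBM _
        _ ≤ (B : ℝ) ^ (2 ^ (m + 1) - 1) := pow_le_pow_right₀ hB1 (succ_le_two_pow_succ_sub_one m)
    have hup := ha_up m
    set D : ℝ := (B : ℝ) ^ (2 ^ (m + 1) - 1) with hD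
    have hD0 : 0 < D := by positivity
    have hσne := hσ0.ne'
    have hBne := hB0.ne'
    calc af (m + 1) ≤ Q (m + 1) * β m ^ 12 / σ := hup
      _ = (M : ℝ) ^ (m + 1) * D ^ 14 := by rw [hQD, hb12, hκ₀]; field_simp
      _ ≤ D * D ^ 14 := mul_le_mul_of_nonneg_right hMD (by positivity)
      _ = D ^ 15 := by ring
  · -- level ratio `N_{m+1}/N_m = b_m^16`
    intro m
    show ((Nf (m + 1) : ℕ) : ℝ) / ((Nf m : ℕ) : ℝ) = ((B ^ 2 ^ m : ℕ) : ℝ) ^ 16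
    rw [hratio, hβcast]
  · -- (T2) `ν_{m+1} b_m⁴ ≤ 1`
    intro m
    show F.cellVisc (m + 1) * ((B ^ 2 ^ m : ℕ) : ℝ) ^ 4 ≤ 1
    rw [hcell, hβcast]
    have := (le_div_iff₀ (pow_pos (hβ0 m) 4)).1 (hL m).2.2.2.2.1
    linarith
  · -- (T3) `K b_m⁴ ≤ b_m¹⁶ ν_{m+1}`
    intro m
    show K * ((B ^ 2 ^ m : ℕ) : ℝ) ^ 4 ≤ ((B ^ 2 ^ m : ℕ) : ℝ) ^ 16 * F.cellVisc (m + 1)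
    rw [hcell, hβcast]
    have h := (div_le_iff₀ (pow_pos (hβ0 m) 12)).1 (hνK m)
    have hb4 : (0 : ℝ) ≤ β m ^ 4 := (pow_pos (hβ0 m) 4).le
    calc K * β m ^ 4 ≤ (ν (m + 1) * β m ^ 12) * β m ^ 4 := mul_le_mul_of_nonneg_right h hb4
      _ = β m ^ 16 * ν (m + 1) := by ring
  · -- period ratio `physPeriod m = M b_m⁸ · physPeriod (m+1)`
    intro m
    show F.physPeriod m = (M : ℝ) * ((B ^ 2 ^ m : ℕ) : ℝ) ^ 8 * F.physPeriod (m + 1)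
    rw [hpp, hpp, hQsucc, hβcast]
    have := (hQpos m).ne'; have := hM0.ne'; have := (hβ0 m).ne'
    field_simp
  · -- STRAIN: `(a_1 + ⋯ + a_m) · b_m · physPeriod (m+1) ≤ θ₀/b_m`
    intro m
    show (∑ i ∈ Finset.range m, af (i + 1)) * (((B ^ 2 ^ m : ℕ) : ℝ) * F.physPeriod (m + 1)) ≤
      θ₀ / ((B ^ 2 ^ m : ℕ) : ℝ)
    rw [hβcast]
    cases m with
    | zero =>
      rw [Finset.sum_range_zero, zero_mul]
      exact (div_pos hθ₀ (hβ0 0)).le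
    | succ n =>
      rw [hpp, hQsucc (n + 1)]
      have hS := ha_sum n
      have hup := ha_up n
      rw [hβ12] at hup
      have hb0 := hβ0 (n + 1)
      have hQ1 := hQpos (n + 1)
      have hS' : ∑ i ∈ Finset.range (n + 1), af (i + 1) ≤ 2 * (Q (n + 1) * β (n + 1) ^ 6 / σ) := by
        linarith
      have h2Pσ : 2 * P / σ ≤ θ₀ * M := by
        rw [div_le_iff₀ hσ0]
        have h1 : 2 * (θ₀ * M) ≤ σ * (θ₀ * M) := mul_le_mul_of_nonneg_right hσ2 (by positivity)
        calc 2 * P ≤ 2 * (θ₀ * M) := by linarith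
          _ ≤ σ * (θ₀ * M) := h1
          _ = θ₀ * M * σ := by ring
      have hden1 : 0 < Q (n + 1) * (M * β (n + 1) ^ 8) := by positivity
      rw [le_div_iff₀ hb0]
      have e : (∑ i ∈ Finset.range (n + 1), af (i + 1)) *
          (β (n + 1) * (P / (Q (n + 1) * (M * β (n + 1) ^ 8)))) * β (n + 1) =
          (∑ i ∈ Finset.range (n + 1), af (i + 1)) * (β (n + 1) ^ 2 * P) /
            (Q (n + 1) * (M * β (n + 1) ^ 8)) := by ring
      rw [e, div_le_iff₀ hden1]
      calc (∑ i ∈ Finset.range (n + 1), af (i + 1)) * (β (n + 1) ^ 2 * P)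
          ≤ 2 * (Q (n + 1) * β (n + 1) ^ 6 / σ) * (β (n + 1) ^ 2 * P) :=
            mul_le_mul_of_nonneg_right hS' (by positivity)
        _ = (2 * P / σ) * (Q (n + 1) * β (n + 1) ^ 8) := by ring
        _ ≤ (θ₀ * M) * (Q (n + 1) * β (n + 1) ^ 8) := mul_le_mul_of_nonneg_right h2Pσ (by positivity)
        _ = θ₀ * (Q (n + 1) * (M * β (n + 1) ^ 8)) := by ring

end Summit.AnomalousDissipation.AnomalousDissipation.Theorems.SolenoidalFractalHomogenisation.LagrangianCarrierConstruction

end
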